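import Literature.AlgebraicGeometry.Morphisms.ProjectiveMorphismComposition
import HarnessLib

/-!
# A projective morphism embeds into a projective space of positive dimension

Topic `Literature/AlgebraicGeometry/Morphisms`; sequel of `Morphisms/ProjectiveMorphism`
(`Literature.AlgebraicGeometry.Morphisms.IsProjective f`: `f` factors as a closed immersion
`X ↪ 𝐏(ι; Y) = Y ×_{Spec ℤ} 𝐏^{#ι}_ℤ` followed by the projection, Hartshorne II §4 p. 103) and
`Morphisms/ProjectiveMorphismComposition` (base change, composition via the Segre embedding over the
base, products).  The definition allows `#ι = 0`, i.e. `𝐏⁰_Y = Y`; consumers that feed the closed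
immersion to the tree's Hilbert scheme of `𝐏(ι)` (`Motives/HilbertImageInGrassmannianUniversalFamily`,
hypothesis `1 ≤ #ι`) need an ambient projective space of POSITIVE dimension.  This file supplies it,
over an ARBITRARY base and without any linear embedding `𝐏ⁿ ⊂ 𝐏ⁿ⁺¹`:

* `exists_hom_projectiveSpace_comp_fst_eq` — every `Y`-scheme `f : X → Y` admits a `Y`-morphism
  `X → 𝐏(ι; Y)` (the origin of the standard affine chart: Mathlib `AffineSpace.homOfVector f 0`
  followed by the tree's open immersion `𝔸(ι; Y) ↪ 𝐏(ι; Y)`).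
* `IsProjective.exists_isClosedImmersion_one_le_card` — **a projective `f : X → Y` factors through a
  closed immersion `X ↪ 𝐏(τ; Y)` with `1 ≤ #τ`**: from `j : X ↪ 𝐏(κ; Y)` and the `Y`-morphism
  `c : X → 𝐏¹_Y` above, `(j, c) : X → 𝐏(κ; Y) ×_Y 𝐏¹_Y` is a closed immersion (its composite with
  the separated first projection is `j`; Mathlib `IsClosedImmersion.of_comp`), and the Segre
  embedding over `Y` (`Literature.AlgebraicGeometry.Morphisms.segreOver`, Stacks 01WD) lands it in
  `𝐏(τ; Y)` with `#τ + 1 = 2 (#κ + 1)`, so `#τ = 2 #κ + 1 ≥ 1` (Hartshorne II Ex. 4.9, the Segre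
  trick).
* `IsProjective.exists_isClosedImmersion_pullback_one_le_card` — for projective `q : Y → S`,
  `p : X → S`: a closed `S`-immersion `Y ×_S X ↪ 𝐏(ι; S)` with `1 ≤ #ι`
  (`IsProjective.prod` + the above) — the form consumed by the Hom-scheme construction
  ([MumfordFogartyKirwan1994] Ch. 0 §5 (c): `Hom_S(Y, X) ⊂ Hilb(Y ×_S X / S)`).

Everything is proved; no definitions, no named facts.

## References

* R. Hartshorne, *Algebraic Geometry*, GTM 52 (1977): II §4 Definition p. 103, II Ex. 4.9.
  [Hartshorne1977]
* The Stacks Project, Tag 01WD (Lemma 27.13.6, the Segre morphism over `S` is a closed immersion).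
  [StacksProject]
* D. Mumford, J. Fogarty, F. Kirwan, *Geometric Invariant Theory*, 3rd ed. (1994), Ch. 0 §5 (c)
  (p. 23). [MumfordFogartyKirwan1994]
-/

noncomputable section

-- Mathlib's pull-back API is stated through `abbrev`s over `limit`; as in Mathlib's own
-- algebraic-geometry files we let `simp`/unification see through them.
set_option backward.isDefEq.respectTransparency false

universe u

open CategoryTheory CategoryTheory.Limits AlgebraicGeometry MonoidalCategory

namespace Literature.AlgebraicGeometry.Morphisms

variable {X Y : Scheme.{u}}

/-- Every `Y`-scheme `f : X → Y` admits a `Y`-morphism to `𝐏(ι; Y)`: the origin of the standard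
affine chart, `X → 𝔸(ι; Y) ↪ 𝐏(ι; Y)` (all chart coordinates `0`).
[cite: Hartshorne1977, II §4 Definition p.103 (projective morphism)] -/
theorem exists_hom_projectiveSpace_comp_fst_eq (f : X ⟶ Y) (ι : Type u) [Finite ι] :
    ∃ c : X ⟶ projectiveSpace ι Y, c ≫ projectiveSpaceFst ι Y = f :=
  ⟨AffineSpace.homOfVector f 0 ≫ affineSpaceToProjectiveSpace ι Y, by
    rw [Category.assoc, affineSpaceToProjectiveSpace_fst, AffineSpace.homOfVector_over]⟩

namespace IsProjective

/-- **A projective morphism factors through a closed immersion into a projective space of positive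
dimension**: if `f : X → Y` is projective then there are a finite `τ` with `1 ≤ #τ` and a closed
immersion `j : X ↪ 𝐏(τ; Y)` with `j ≫ (𝐏(τ; Y) → Y) = f`.  Proof: `X ↪ 𝐏(κ; Y)` and any `Y`-morphism
`X → 𝐏¹_Y` give a closed immersion `X ↪ 𝐏(κ; Y) ×_Y 𝐏¹_Y` (cancellation against the separated
first projection), followed by the Segre embedding over `Y` into `𝐏(τ; Y)`, `#τ = 2 #κ + 1`.
[cite: Hartshorne1977, II Ex. 4.9] [cite: StacksProject, Tag 01WD] -/
theorem exists_isClosedImmersion_one_le_card {f : X ⟶ Y} (hf : IsProjective f) :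
    ∃ (τ : Type u) (_ : Finite τ) (_ : 1 ≤ Nat.card τ) (j : X ⟶ projectiveSpace τ Y)
      (_ : IsClosedImmersion j), j ≫ projectiveSpaceFst τ Y = f := by
  obtain ⟨κ, hκ, j, hj, hjf⟩ := hf
  obtain ⟨τ, hτ, ⟨e⟩⟩ := exists_segreIndex κ PUnit.{u + 1}
  -- numerology: `#τ + 1 = (#κ + 1) · 2`
  have hcard : 1 ≤ Nat.card τ := by
    have h := Fintype.card_congr e
    simp only [Fintype.card_prod, Fintype.card_fin, Nat.card_unique] at h
    omega
  -- a `Y`-morphism `c : X → 𝐏¹_Y`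
  obtain ⟨c, hc⟩ := exists_hom_projectiveSpace_comp_fst_eq f PUnit.{u + 1}
  -- `m = (j, c) : X → 𝐏(κ; Y) ×_Y 𝐏¹_Y`, a closed immersion since `m ≫ pr₁ = j` is and `pr₁` is
  -- separated (base change of the proper `𝐏¹_Y → Y`)
  have hw : j ≫ projectiveSpaceFst κ Y = c ≫ projectiveSpaceFst PUnit.{u + 1} Y := by rw [hjf, hc]
  set m : X ⟶ pullback (projectiveSpaceFst κ Y) (projectiveSpaceFst PUnit.{u + 1} Y) :=
    pullback.lift j c hw with hm
  have hm_fst : m ≫ pullback.fst _ _ = j := pullback.lift_fst _ _ _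
  haveI : IsClosedImmersion (m ≫ pullback.fst (projectiveSpaceFst κ Y)
      (projectiveSpaceFst PUnit.{u + 1} Y)) := by
    rw [hm_fst]; exact hj
  haveI : IsClosedImmersion m :=
    .of_comp m (pullback.fst (projectiveSpaceFst κ Y) (projectiveSpaceFst PUnit.{u + 1} Y))
  -- followed by the Segre embedding over `Y`
  refine ⟨τ, hτ, hcard, m ≫ (segreOver Y e).left, inferInstance, ?_⟩
  change (m ≫ (segreOver Y e).left) ≫ projectiveSpaceFst τ Y = f
  rw [Category.assoc, segreOver_left_fst]
  have hm_fst' : m ≫ pullback.fst (Over.mk (projectiveSpaceFst κ Y)).hom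
      (Over.mk (projectiveSpaceFst PUnit.{u + 1} Y)).hom = j := hm_fst
  rw [reassoc_of% hm_fst', hjf]

/-- **Fibre products of projective `S`-schemes embed in a projective space over `S` of positive
dimension**: for projective `q : Y → S` and `p : X → S` there are a finite `ι` with `1 ≤ #ι` and a
closed immersion `jW : Y ×_S X ↪ 𝐏(ι; S)` over `S` (`jW ≫ (𝐏(ι; S) → S) = pr₁ ≫ q`) — the ambient
projective space in which the Hom-scheme `Hom_S(Y, X)` is cut out of the Hilbert scheme of
`Y ×_S X` (Mumford–Fogarty–Kirwan Ch. 0 §5 (c)).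
[cite: Hartshorne1977, II Ex. 4.9] [cite: MumfordFogartyKirwan1994, Ch. 0 §5 (c) (p. 23)] -/
theorem exists_isClosedImmersion_pullback_one_le_card {S : Scheme.{u}} {q : Y ⟶ S} {p : X ⟶ S}
    (hq : IsProjective q) (hp : IsProjective p) :
    ∃ (ι : Type u) (_ : Finite ι) (_ : 1 ≤ Nat.card ι) (jW : pullback q p ⟶ projectiveSpace ι S)
      (_ : IsClosedImmersion jW), jW ≫ projectiveSpaceFst ι S = pullback.fst q p ≫ q :=
  (hq.prod hp).exists_isClosedImmersion_one_le_card

end IsProjective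

end Literature.AlgebraicGeometry.Morphisms

end
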